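import Mathlib
import Literature.Analysis.FluidPDE.SpaceTimeRescaling
import Literature.Analysis.FluidPDE.PressureDeterminedUpToTime
import Literature.Analysis.FluidPDE.SuitableWeakCongr
import Literature.Analysis.FluidPDE.SelfSimilarCollapseAnsatz
import Summits.NavierStokesRegularity.NavierStokesRegularity.Theorems.EulerZoomLiouvillePowerGaugeEulerLiouvilleSelfSimilarPressureSlavingTools
import Summits.NavierStokesRegularity.NavierStokesRegularity.Theorems.EulerZoomLiouvillePowerGaugeEulerLiouvilleSelfSimilarPressureSlavingProfile
import Summits.NavierStokesRegularity.NavierStokesRegularity.Theorems.EulerZoomLiouvillePowerGaugeEulerLiouvillePressureSwap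
import HarnessLib

/-!
# Crux E `PowerGaugeEulerLiouville` (stmt-NavierStokesRegularity-19832): PRESSURE SLAVING — the pressure of an exactly
# self-similar member of Seregin's class IS (a.e.) the self-similar ansatz of a profile
# (lane «pressure slaving», LEAD ns-typeII-p2 g11 10:21:09Z (4) / 10:28:47Z (a) / 10:45:58Z (1); width seat ns-ezl-w3 g2)

Route `EulerZoomLiouville` (NavierStokesRegularity), crux E = Seregin's power-gauged ancient Euler class on the slab `(−∞,0) × ℝ³`.
The census strata `IsExactlySelfSimilar` / `IsOffRateSelfSimilar` (skeleton `Lines/birth.lean`) carry a VELOCITY clause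
`∀ τ < 0, u τ = selfSimilarCollapse g 0 V τ` AND a PRESSURE clause `∀ τ < 0, p τ = selfSimilarCollapsePressure g 0 P τ`.  This file proves
that the pressure clause is REDUNDANT — in the class the pressure is slaved to the velocity's similarity:
* `isDistributional_rescaledPressure` — COVARIANCE: the Euler rescaling `(s, y) ↦ (β s, β^{g} y)` with amplitude `β^{1−g}` (tree
  `IsDistributionalNSSolutionOn.stRescale`, `(α, β, γ) = (β^{1−g}, β, β^{g})`) FIXES an exactly self-similar velocity of rate `g`, so `(u, p_β)`,
  `p_β(s, y) = β^{2(1−g)} p(β s, β^{g} y)`, is again a distributional Euler solution with the SAME velocity, for every `β > 0`;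
* `ae_eq_rescaledPressure` — hence `p − p_β` is a.e. a function of time (Rusin–Šverák, tree
  `ae_exists_const_of_forall_integral_mul_divergence_eq_zero`), which the `D`-type growth `∫∫_{Q_a}|p|^{3/2} ≤ K a^m`, `m < 3`, kills
  (`…PressureSlavingTools`): `p = p_β` a.e. on the slab;
* `exists_profilePressure` — **SLAVING (P)**: so (`…PressureSlavingProfile`) there is a measurable profile `Q` with
  `p = selfSimilarCollapsePressure g 0 Q` a.e. on the slab (equivalently `p τ = … τ` a.e. on `ℝ³` for a.e. `τ < 0`);
* `inClass_selfSimilarPressure` — **MEMBER FORM (C)**, crux binders verbatim (`ρ > −1/2`), any rate `g`: `InClass ρ u p H c` + the velocity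
  clause ⇒ `InClass ρ u p_Q H c` for `p_Q := selfSimilarCollapsePressure g 0 Q` (via ns-ezl-w2 g2's swap `PressureSwap.inClass_congr_pressure_ae`),
  and the pressure clause holds for `p_Q` by `rfl` — the LEAD may delete the pressure clauses of these strata.
ON THE QUANTIFIER: «`∃ Q, ∀ τ < 0, p τ =ᵐ …`» is FALSE in the class (`p` may be modified freely on one slice: `u = 0`, `H = 0`, `c = 0`,
`p = 𝟙_{τ = −1}` is a member with no such `Q`); the true statement is a.e. in `τ` / a.e. on the slab, which is what is proved.
WHAT THIS IS NOT: not NS regularity, not the crux E — a de-conditioning lemma for the census of the crux CLASS 19832 on the MODEL lattice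
(it deletes hypotheses from strata, it excludes nothing by itself); `--supports` stmt-19832.
[folklore; RusinSverak2011 §2 p. 4; CaffarelliKohnNirenberg1982 §2 (scaling covariance); ConstantinIgnatovaVicol2026Putative §3.1 (3.2)]
-/


noncomputable section

-- flat `Theorems/<Route><Decl>…` files of one crux share the namespace of the crux (tree convention: `Summit.<S>.<S>.…`)
set_option linter.dupNamespace false

open MeasureTheory Set Filter Topology Metric Function TopologicalSpace
open scoped ENNReal NNReal InnerProductSpace RealInnerProductSpace

namespace Summit.NavierStokesRegularity.NavierStokesRegularity.Theorems.PowerGaugeEulerLiouville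

open Literature.Analysis Literature.Analysis.FunctionSpaces Literature.Analysis.FluidPDE

namespace PressureSlaving

/-! ### The self-similar rescalings fix an exactly self-similar velocity -/

/-- The slab `(−∞,0) × ℝ³` is invariant under the rescalings `(s, y) ↦ (β s, γ y)`, `β > 0`. [folklore] -/
theorem stPreimage_slab {β : ℝ} (hβ : 0 < β) (γ : ℝ) :
    stPreimage β γ 0 (0 : EuclideanSpace ℝ (Fin 3)) (slab (EuclideanSpace ℝ (Fin 3)) (Iio 0) isOpen_Iio) =
      slab (EuclideanSpace ℝ (Fin 3)) (Iio 0) isOpen_Iio := by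
  apply TopologicalSpace.Opens.ext
  ext z
  simp only [coe_stPreimage, coe_slab, mem_preimage, mem_prod, mem_univ, and_true, mem_Iio, stAffine_fst, zero_add]
  constructor
  · intro h
    by_contra h'
    exact absurd h (not_lt.2 (mul_nonneg hβ.le (not_lt.1 h')))
  · intro h
    exact mul_neg_of_pos_of_neg hβ h

/-- **The rescaling `(α, β, γ) = (β^{1−g}, β, β^{g})` fixes an exactly self-similar velocity of rate `g`** (pointwise on the slab):
`β^{1−g} u(β s, β^{g} y) = u(s, y)` for `s < 0`. [folklore; ConstantinIgnatovaVicol2026Putative §3.1 (3.2)] -/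
theorem selfSimilar_smul_stPull_apply {g β : ℝ} (hβ : 0 < β)
    {u : ℝ → EuclideanSpace ℝ (Fin 3) → EuclideanSpace ℝ (Fin 3)} {V : EuclideanSpace ℝ (Fin 3) → EuclideanSpace ℝ (Fin 3)}
    (hu : ∀ τ : ℝ, τ < 0 → u τ = selfSimilarCollapse g 0 V τ) {s : ℝ} (hs : s < 0) (y : EuclideanSpace ℝ (Fin 3)) :
    (β ^ (1 - g) • stPull β (β ^ g) 0 (0 : EuclideanSpace ℝ (Fin 3)) u) s y = u s y := by
  have hβs : β * s < 0 := mul_neg_of_pos_of_neg hβ hs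
  rw [smul_stPull_apply, zero_add, zero_add, hu _ hβs, hu s hs]
  simp only [selfSimilarCollapse_apply, zero_sub]
  have hns : 0 ≤ -s := (neg_pos.2 hs).le
  have e1 : -(β * s) = β * (-s) := by ring
  rw [e1, Real.mul_rpow hβ.le hns, Real.mul_rpow hβ.le hns, smul_smul, smul_smul]
  have e2 : β ^ (1 - g) * (β ^ (g - 1) * (-s) ^ (g - 1)) = (-s) ^ (g - 1) := by
    rw [← mul_assoc, ← Real.rpow_add hβ, show (1 - g) + (g - 1) = 0 by ring, Real.rpow_zero, one_mul]
  have e3 : β ^ (-g) * (-s) ^ (-g) * β ^ g = (-s) ^ (-g) := by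
    rw [mul_comm, ← mul_assoc, ← Real.rpow_add hβ, show g + -g = 0 by ring, Real.rpow_zero, one_mul]
  rw [e2, e3]

/-- **COVARIANCE.**  If `(u, p)` is a distributional Euler solution (no force) on the slab `(−∞,0) × ℝ³` and `u` is exactly self-similar of
rate `g`, `u τ = selfSimilarCollapse g 0 V τ` for `τ < 0`, then for every `β > 0` the pair `(u, p_β)`,
`p_β = (β^{1−g})² • stPull β β^{g} 0 0 p` (i.e. `p_β(s, y) = β^{2(1−g)} p(β s, β^{g} y)`), is a distributional Euler solution on the slab
with the SAME velocity (tree `IsDistributionalNSSolutionOn.stRescale` + `congr_ae`). [cite: CaffarelliKohnNirenberg1982, §2] -/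
theorem isDistributional_rescaledPressure {g β : ℝ} (hβ : 0 < β)
    {u : ℝ → EuclideanSpace ℝ (Fin 3) → EuclideanSpace ℝ (Fin 3)} {p : ℝ → EuclideanSpace ℝ (Fin 3) → ℝ}
    {V : EuclideanSpace ℝ (Fin 3) → EuclideanSpace ℝ (Fin 3)}
    (hdist : IsDistributionalNSSolutionOn (slab (EuclideanSpace ℝ (Fin 3)) (Iio 0) isOpen_Iio) 0 0 u p)
    (hu : ∀ τ : ℝ, τ < 0 → u τ = selfSimilarCollapse g 0 V τ) :
    IsDistributionalNSSolutionOn (slab (EuclideanSpace ℝ (Fin 3)) (Iio 0) isOpen_Iio) 0 0 u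
      ((β ^ (1 - g)) ^ 2 • stPull β (β ^ g) 0 (0 : EuclideanSpace ℝ (Fin 3)) p) := by
  have hα : 0 < β ^ (1 - g) := Real.rpow_pos_of_pos hβ _
  have hγ : 0 < β ^ g := Real.rpow_pos_of_pos hβ _
  have hβeq : β = β ^ (1 - g) * β ^ g := by
    rw [← Real.rpow_add hβ, show (1 - g) + g = 1 by ring, Real.rpow_one]
  have h := hdist.stRescale hα hγ hβeq 0 (0 : EuclideanSpace ℝ (Fin 3))
  rw [stPreimage_slab hβ, mul_zero, zero_div] at h
  have h0 : ((β ^ (1 - g)) ^ 2 * β ^ g) • stPull β (β ^ g) 0 (0 : EuclideanSpace ℝ (Fin 3))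
      (0 : ℝ → EuclideanSpace ℝ (Fin 3) → EuclideanSpace ℝ (Fin 3)) = 0 := by
    funext s y
    rw [smul_stPull_apply]
    simp
  rw [h0] at h
  refine h.congr_ae ?_ (ae_of_all _ fun _ => rfl)
  rw [coe_slab]
  filter_upwards [ae_restrict_mem (measurableSet_Iio.prod MeasurableSet.univ)] with z hz
  exact selfSimilar_smul_stPull_apply hβ hu (mem_prod.1 hz).1 z.2

/-! ### `p = p_β` a.e. on the slab -/

/-- Backward cylinders `Q_a(0)` lie in the preimage of `Q_{(β+γ+1)a}(0)` under `(s, y) ↦ (β s, γ y)` (`β, γ, a > 0`). [folklore] -/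
theorem parabolicCylinder_subset_preimage {β γ a : ℝ} (hβ : 0 < β) (hγ : 0 < γ) (ha : 0 < a) :
    parabolicCylinder a (0 : ℝ × EuclideanSpace ℝ (Fin 3)) ⊆
      stAffine β γ 0 (0 : EuclideanSpace ℝ (Fin 3)) ⁻¹' parabolicCylinder ((β + γ + 1) * a) (0 : ℝ × EuclideanSpace ℝ (Fin 3)) := by
  rintro ⟨t, x⟩ hz
  rw [mem_parabolicCylinder] at hz
  simp only [Prod.fst_zero, Prod.snd_zero, zero_sub, dist_zero_right] at hz
  rw [mem_preimage, mem_parabolicCylinder]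
  simp only [stAffine_fst, stAffine_snd, Prod.fst_zero, Prod.snd_zero, zero_sub, zero_add, dist_zero_right, norm_smul,
    Real.norm_eq_abs, abs_of_pos hγ]
  obtain ⟨⟨ht1, ht2⟩, hx⟩ := hz
  refine ⟨⟨?_, mul_neg_of_pos_of_neg hβ ht2⟩, ?_⟩
  · have h1 : -(β * a ^ 2) < β * t := by nlinarith
    have h2 : β * a ^ 2 ≤ ((β + γ + 1) * a) ^ 2 := by nlinarith [sq_nonneg a, sq_nonneg (β + γ), hβ.le, hγ.le]
    linarith
  · calc γ * ‖x‖ < γ * a := mul_lt_mul_of_pos_left hx hγ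
      _ ≤ (β + γ + 1) * a := by nlinarith

/-- **`p = p_β` A.E. ON THE SLAB.**  Under the hypotheses of `isDistributional_rescaledPressure` and the `D`-type growth
`∫∫_{Q_a(0)} |p|^{3/2} ≤ K a^m` for `a ≥ a₀` (`K < ∞`, `m < 3`; the crux class has `m = 2 − 2ρ`): for every `β > 0`,
`p(s, y) = β^{2(1−g)} p(β s, β^{g} y)` for a.e. `(s, y)` in the slab.  Proof: `p − p_β` is a function of time a.e. (two pressures of one
velocity, Rusin–Šverák), has the same growth, and the growth `m < 3` kills functions of time. [folklore; RusinSverak2011 §2 p. 4] -/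
theorem ae_eq_rescaledPressure {g β : ℝ} (hβ : 0 < β)
    {u : ℝ → EuclideanSpace ℝ (Fin 3) → EuclideanSpace ℝ (Fin 3)} {p : ℝ → EuclideanSpace ℝ (Fin 3) → ℝ}
    {V : EuclideanSpace ℝ (Fin 3) → EuclideanSpace ℝ (Fin 3)}
    (hdist : IsDistributionalNSSolutionOn (slab (EuclideanSpace ℝ (Fin 3)) (Iio 0) isOpen_Iio) 0 0 u p)
    {K : ℝ≥0∞} (hK : K ≠ ⊤) {m a₀ : ℝ} (hm : m < 3)
    (hD : ∀ a : ℝ, a₀ ≤ a →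
      ∫⁻ z in parabolicCylinder a (0 : ℝ × EuclideanSpace ℝ (Fin 3)), ‖p z.1 z.2‖ₑ ^ (3 / 2 : ℝ) ≤ K * ENNReal.ofReal (a ^ m))
    (hu : ∀ τ : ℝ, τ < 0 → u τ = selfSimilarCollapse g 0 V τ) :
    ∀ᵐ z ∂(volume.restrict (Iio (0 : ℝ) ×ˢ (univ : Set (EuclideanSpace ℝ (Fin 3))))),
      p z.1 z.2 = (β ^ (1 - g)) ^ 2 * p (β * z.1) (β ^ g • z.2) := by
  set γ : ℝ := β ^ g with hγdef
  have hγ : 0 < γ := Real.rpow_pos_of_pos hβ _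
  set q : ℝ → EuclideanSpace ℝ (Fin 3) → ℝ := (β ^ (1 - g)) ^ 2 • stPull β γ 0 (0 : EuclideanSpace ℝ (Fin 3)) p with hqdef
  have hq : IsDistributionalNSSolutionOn (slab (EuclideanSpace ℝ (Fin 3)) (Iio 0) isOpen_Iio) 0 0 u q :=
    isDistributional_rescaledPressure hβ hdist hu
  set F : ℝ → EuclideanSpace ℝ (Fin 3) → ℝ := fun t x => p t x - q t x with hFdef
  suffices hF0 : ∀ᵐ z ∂(volume.restrict (Iio (0 : ℝ) ×ˢ (univ : Set (EuclideanSpace ℝ (Fin 3))))), F z.1 z.2 = 0 by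
    filter_upwards [hF0] with z hz
    have e : p z.1 z.2 = q z.1 z.2 := sub_eq_zero.1 hz
    rw [e, hqdef, smul_stPull_apply, zero_add, zero_add, smul_eq_mul]
  -- ### measurability
  have hpl : LocallyIntegrableOn (uncurry p) (Iio (0 : ℝ) ×ˢ (univ : Set (EuclideanSpace ℝ (Fin 3)))) volume := by
    have h := hdist.2.2.1; rwa [coe_slab] at h
  have hql : LocallyIntegrableOn (uncurry q) (Iio (0 : ℝ) ×ˢ (univ : Set (EuclideanSpace ℝ (Fin 3)))) volume := by
    have h := hq.2.2.1; rwa [coe_slab] at h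
  have hFl : LocallyIntegrableOn (uncurry F) (Iio (0 : ℝ) ×ˢ (univ : Set (EuclideanSpace ℝ (Fin 3)))) volume :=
    hpl.sub hql
  have hFm : AEStronglyMeasurable (uncurry F)
      (volume.restrict (Iio (0 : ℝ) ×ˢ (univ : Set (EuclideanSpace ℝ (Fin 3))))) := hFl.aestronglyMeasurable
  -- ### `F` is a function of time a.e. (two pressures of one velocity, on each slab `(T₁, 0) × ℝ³`)
  have hconstT : ∀ T₁ : ℝ, ∀ᵐ t ∂(volume.restrict (Ioo T₁ 0)), ∃ κ : ℝ,
      ∀ᵐ x ∂(volume : Measure (EuclideanSpace ℝ (Fin 3))), F t x = κ := by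
    intro T₁
    have hle : slab (EuclideanSpace ℝ (Fin 3)) (Ioo T₁ 0) isOpen_Ioo ≤
        slab (EuclideanSpace ℝ (Fin 3)) (Iio 0) isOpen_Iio := slab_mono Ioo_subset_Iio_self
    have hp' := hdist.of_le hle
    have hq' := hq.of_le hle
    refine ae_exists_const_of_forall_integral_mul_divergence_eq_zero (hFl.mono_set (prod_mono Ioo_subset_Iio_self le_rfl)) ?_
    intro ψ hψ
    have h := setIntegral_sub_mul_divergence_eq_zero hp' hq' hψ
    rwa [coe_slab] at h
  have hconst : ∀ᵐ t ∂(volume.restrict (Iio (0 : ℝ))), ∃ κ : ℝ,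
      ∀ᵐ x ∂(volume : Measure (EuclideanSpace ℝ (Fin 3))), F t x = κ := by
    have hcover : Iio (0 : ℝ) ⊆ ⋃ n : ℕ, Ioo (-((n : ℝ) + 1)) 0 := by
      intro t ht
      obtain ⟨n, hn⟩ := exists_nat_gt (-t)
      exact mem_iUnion.2 ⟨n, ⟨by linarith, ht⟩⟩
    exact ae_restrict_of_ae_restrict_of_subset hcover ((ae_restrict_iUnion_iff _ _).2 fun n => hconstT _)
  -- ### the growth of `F`
  set L : ℝ := β + γ + 1 with hL
  have hL1 : 1 ≤ L := by rw [hL]; linarith [hβ.le, hγ.le]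
  set Kβ : ℝ≥0∞ := ‖(β ^ (1 - g)) ^ 2‖ₑ ^ (3 / 2 : ℝ) *
    ENNReal.ofReal (β * γ ^ Module.finrank ℝ (EuclideanSpace ℝ (Fin 3)))⁻¹ with hKβ
  have hKβtop : Kβ ≠ ⊤ :=
    ENNReal.mul_ne_top (ENNReal.rpow_ne_top_of_nonneg (by norm_num) enorm_ne_top) ENNReal.ofReal_ne_top
  have hgrowth : ∀ a : ℝ, max a₀ 1 ≤ a →
      ∫⁻ z in parabolicCylinder a (0 : ℝ × EuclideanSpace ℝ (Fin 3)), ‖F z.1 z.2‖ₑ ^ (3 / 2 : ℝ) ≤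
        (2 ^ ((3 / 2 : ℝ) - 1) * (K + Kβ * K * ENNReal.ofReal (L ^ m))) * ENNReal.ofReal (a ^ m) := by
    intro a ha
    have ha₀ : a₀ ≤ a := (le_max_left _ _).trans ha
    have ha1 : 1 ≤ a := (le_max_right _ _).trans ha
    have ha0 : 0 < a := one_pos.trans_le ha1
    -- the bound for `q` by change of variables
    have hqa : ∫⁻ z in parabolicCylinder a (0 : ℝ × EuclideanSpace ℝ (Fin 3)), ‖q z.1 z.2‖ₑ ^ (3 / 2 : ℝ) ≤
        Kβ * K * ENNReal.ofReal (L ^ m) * ENNReal.ofReal (a ^ m) := by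
      have hsub := parabolicCylinder_subset_preimage hβ hγ ha0
      calc ∫⁻ z in parabolicCylinder a (0 : ℝ × EuclideanSpace ℝ (Fin 3)), ‖q z.1 z.2‖ₑ ^ (3 / 2 : ℝ)
          ≤ ∫⁻ z in stAffine β γ 0 (0 : EuclideanSpace ℝ (Fin 3)) ⁻¹'
              parabolicCylinder (L * a) (0 : ℝ × EuclideanSpace ℝ (Fin 3)), ‖q z.1 z.2‖ₑ ^ (3 / 2 : ℝ) :=
            lintegral_mono_set hsub
        _ = Kβ * ∫⁻ z in parabolicCylinder (L * a) (0 : ℝ × EuclideanSpace ℝ (Fin 3)), ‖p z.1 z.2‖ₑ ^ (3 / 2 : ℝ) := by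
            rw [hqdef, setLIntegral_enorm_rpow_stRescale hβ hγ 0 (0 : EuclideanSpace ℝ (Fin 3)) _ p _ (by norm_num), hKβ]
        _ ≤ Kβ * (K * ENNReal.ofReal ((L * a) ^ m)) := by
            gcongr
            exact hD _ (ha₀.trans (by nlinarith))
        _ = Kβ * K * ENNReal.ofReal (L ^ m) * ENNReal.ofReal (a ^ m) := by
            rw [Real.mul_rpow (by linarith) ha0.le, ENNReal.ofReal_mul (Real.rpow_nonneg (by linarith) _)]
            ring
    have hpa := hD a ha₀
    -- measurability on the cylinder
    have hsubQ : parabolicCylinder a (0 : ℝ × EuclideanSpace ℝ (Fin 3)) ⊆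
        Iio (0 : ℝ) ×ˢ (univ : Set (EuclideanSpace ℝ (Fin 3))) := by
      rintro ⟨t, x⟩ hz
      rw [mem_parabolicCylinder] at hz
      exact mem_prod.2 ⟨by simpa using hz.1.2, mem_univ _⟩
    have hpmQ : AEMeasurable (fun z : ℝ × EuclideanSpace ℝ (Fin 3) => ‖p z.1 z.2‖ₑ ^ (3 / 2 : ℝ))
        (volume.restrict (parabolicCylinder a (0 : ℝ × EuclideanSpace ℝ (Fin 3)))) :=
      ((hpl.aestronglyMeasurable.mono_measure (Measure.restrict_mono hsubQ le_rfl)).aemeasurable.enorm.pow_const _)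
    -- assemble
    calc ∫⁻ z in parabolicCylinder a (0 : ℝ × EuclideanSpace ℝ (Fin 3)), ‖F z.1 z.2‖ₑ ^ (3 / 2 : ℝ)
        ≤ ∫⁻ z in parabolicCylinder a (0 : ℝ × EuclideanSpace ℝ (Fin 3)),
            2 ^ ((3 / 2 : ℝ) - 1) * (‖p z.1 z.2‖ₑ ^ (3 / 2 : ℝ) + ‖q z.1 z.2‖ₑ ^ (3 / 2 : ℝ)) := by
          refine lintegral_mono fun z => ?_
          calc ‖F z.1 z.2‖ₑ ^ (3 / 2 : ℝ) ≤ (‖p z.1 z.2‖ₑ + ‖q z.1 z.2‖ₑ) ^ (3 / 2 : ℝ) := by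
                gcongr
                exact enorm_sub_le
            _ ≤ 2 ^ ((3 / 2 : ℝ) - 1) * (‖p z.1 z.2‖ₑ ^ (3 / 2 : ℝ) + ‖q z.1 z.2‖ₑ ^ (3 / 2 : ℝ)) :=
                ENNReal.rpow_add_le_mul_rpow_add_rpow _ _ (by norm_num)
      _ = 2 ^ ((3 / 2 : ℝ) - 1) * ((∫⁻ z in parabolicCylinder a (0 : ℝ × EuclideanSpace ℝ (Fin 3)), ‖p z.1 z.2‖ₑ ^ (3 / 2 : ℝ)) +
            ∫⁻ z in parabolicCylinder a (0 : ℝ × EuclideanSpace ℝ (Fin 3)), ‖q z.1 z.2‖ₑ ^ (3 / 2 : ℝ)) := by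
          rw [lintegral_const_mul' _ _ (ENNReal.rpow_ne_top_of_nonneg (by norm_num) ENNReal.ofNat_ne_top),
            lintegral_add_left' hpmQ]
      _ ≤ 2 ^ ((3 / 2 : ℝ) - 1) * (K * ENNReal.ofReal (a ^ m) + Kβ * K * ENNReal.ofReal (L ^ m) * ENNReal.ofReal (a ^ m)) := by
          gcongr
      _ = (2 ^ ((3 / 2 : ℝ) - 1) * (K + Kβ * K * ENNReal.ofReal (L ^ m))) * ENNReal.ofReal (a ^ m) := by ring
  -- ### the growth kills `F`
  have hKtot : 2 ^ ((3 / 2 : ℝ) - 1) * (K + Kβ * K * ENNReal.ofReal (L ^ m)) ≠ ⊤ := by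
    refine ENNReal.mul_ne_top (ENNReal.rpow_ne_top_of_nonneg (by norm_num) ENNReal.ofNat_ne_top) ?_
    exact ENNReal.add_ne_top.2 ⟨hK, ENNReal.mul_ne_top (ENNReal.mul_ne_top hKβtop hK) ENNReal.ofReal_ne_top⟩
  exact ae_eq_zero_of_ae_const_of_cylinderGrowth (r := 3 / 2) (by norm_num) hFm hconst hKtot hm hgrowth

/-! ### The slaving theorem -/

/-- The self-similar ansatz pressure of a measurable profile is measurable on `ℝ × ℝ³`. [folklore] -/
theorem measurable_uncurry_selfSimilarCollapsePressure (g : ℝ) {Q : EuclideanSpace ℝ (Fin 3) → ℝ} (hQ : Measurable Q) :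
    Measurable (uncurry (selfSimilarCollapsePressure g 0 Q)) := by
  have e : uncurry (selfSimilarCollapsePressure g 0 Q) =
      fun z : ℝ × EuclideanSpace ℝ (Fin 3) => (0 - z.1) ^ (2 * (g - 1)) * Q ((0 - z.1) ^ (-g) • z.2) := by
    funext z
    rfl
  rw [e]
  exact ((measurable_fst.const_sub 0).pow_const _).mul
    (hQ.comp (((measurable_fst.const_sub 0).pow_const _).smul measurable_snd))

/-- **Slices to slab.**  Two a.e.-strongly measurable functions on the slab `(−∞,0) × ℝ³` whose slices agree a.e. on `ℝ³` for a.e. `τ < 0`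
agree a.e. on the slab (Fubini for the measurable set `{p̃ = p̃'}` of strongly measurable modifications). [folklore] -/
theorem ae_slab_of_ae_slices {p p' : ℝ → EuclideanSpace ℝ (Fin 3) → ℝ}
    (hpm : AEStronglyMeasurable (uncurry p)
      (volume.restrict (Iio (0 : ℝ) ×ˢ (univ : Set (EuclideanSpace ℝ (Fin 3))))))
    (hp'm : AEStronglyMeasurable (uncurry p')
      (volume.restrict (Iio (0 : ℝ) ×ˢ (univ : Set (EuclideanSpace ℝ (Fin 3))))))
    (hp : ∀ᵐ τ ∂(volume.restrict (Iio (0 : ℝ))), p τ =ᵐ[volume] p' τ) :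
    ∀ᵐ z ∂(volume.restrict (Iio (0 : ℝ) ×ˢ (univ : Set (EuclideanSpace ℝ (Fin 3))))), p z.1 z.2 = p' z.1 z.2 := by
  rw [volume_restrict_slab_eq_prod] at hpm hp'm ⊢
  have hS : MeasurableSet {z : ℝ × EuclideanSpace ℝ (Fin 3) | hpm.mk (uncurry p) z = hp'm.mk (uncurry p') z} :=
    hpm.stronglyMeasurable_mk.measurableSet_eq_fun hp'm.stronglyMeasurable_mk
  have h1 := Measure.ae_ae_of_ae_prod hpm.ae_eq_mk
  have h2 := Measure.ae_ae_of_ae_prod hp'm.ae_eq_mk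
  have h3 : ∀ᵐ τ ∂((volume : Measure ℝ).restrict (Iio 0)), ∀ᵐ x ∂(volume : Measure (EuclideanSpace ℝ (Fin 3))),
      (τ, x) ∈ {z : ℝ × EuclideanSpace ℝ (Fin 3) | hpm.mk (uncurry p) z = hp'm.mk (uncurry p') z} := by
    filter_upwards [hp, h1, h2] with τ hτ h1τ h2τ
    filter_upwards [hτ, h1τ, h2τ] with x hx h1x h2x
    show hpm.mk (uncurry p) (τ, x) = hp'm.mk (uncurry p') (τ, x)
    rw [← h1x, ← h2x]
    exact hx
  have h4 := (Measure.ae_prod_mem_iff_ae_ae_mem hS).2 h3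
  filter_upwards [hpm.ae_eq_mk, hp'm.ae_eq_mk, h4] with z hz1 hz2 hz
  have e : uncurry p z = uncurry p' z := by rw [hz1, hz2]; exact hz
  simpa only [uncurry] using e

/-- **PRESSURE SLAVING (P).**  Let `(u, p)` be a distributional Euler solution (no force) on the slab `(−∞,0) × ℝ³` with the `D`-type growth
`∫∫_{Q_a(0)} |p|^{3/2} ≤ K a^m` for `a ≥ a₀` (`K < ∞`, exponent `m < 3`; in Seregin's `ρ`-class `m = 2 − 2ρ`), and let the velocity be
EXACTLY SELF-SIMILAR of ANY rate `g`: `u τ = selfSimilarCollapse g 0 V τ` for `τ < 0`.  Then the pressure is the self-similar ansatz of a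
measurable profile `Q`: `p(τ, y) = (−τ)^{2(g−1)} Q((−τ)^{−g} y)`, i.e. `p τ = selfSimilarCollapsePressure g 0 Q τ` a.e. on `ℝ³` for a.e.
`τ < 0`, and `p = selfSimilarCollapsePressure g 0 Q` a.e. on the slab.  (The quantifier «for EVERY `τ < 0`» would be false: the class sees
`p` only through space–time integrals.) [folklore; RusinSverak2011 §2 p. 4; CaffarelliKohnNirenberg1982 §2] -/
theorem exists_profilePressure {g : ℝ}
    {u : ℝ → EuclideanSpace ℝ (Fin 3) → EuclideanSpace ℝ (Fin 3)} {p : ℝ → EuclideanSpace ℝ (Fin 3) → ℝ}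
    {V : EuclideanSpace ℝ (Fin 3) → EuclideanSpace ℝ (Fin 3)}
    (hdist : IsDistributionalNSSolutionOn (slab (EuclideanSpace ℝ (Fin 3)) (Iio 0) isOpen_Iio) 0 0 u p)
    {K : ℝ≥0∞} (hK : K ≠ ⊤) {m a₀ : ℝ} (hm : m < 3)
    (hD : ∀ a : ℝ, a₀ ≤ a →
      ∫⁻ z in parabolicCylinder a (0 : ℝ × EuclideanSpace ℝ (Fin 3)), ‖p z.1 z.2‖ₑ ^ (3 / 2 : ℝ) ≤ K * ENNReal.ofReal (a ^ m))
    (hu : ∀ τ : ℝ, τ < 0 → u τ = selfSimilarCollapse g 0 V τ) :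
    ∃ Q : EuclideanSpace ℝ (Fin 3) → ℝ, Measurable Q ∧
      (∀ᵐ τ ∂(volume.restrict (Iio (0 : ℝ))), p τ =ᵐ[volume] selfSimilarCollapsePressure g 0 Q τ) ∧
      ∀ᵐ z ∂(volume.restrict (Iio (0 : ℝ) ×ˢ (univ : Set (EuclideanSpace ℝ (Fin 3))))),
        p z.1 z.2 = selfSimilarCollapsePressure g 0 Q z.1 z.2 := by
  have hpm : AEStronglyMeasurable (uncurry p)
      (volume.restrict (Iio (0 : ℝ) ×ˢ (univ : Set (EuclideanSpace ℝ (Fin 3))))) := by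
    have h := hdist.2.2.1.aestronglyMeasurable; rwa [coe_slab] at h
  obtain ⟨Q, hQm, hQ⟩ := exists_profile_of_scaleInvariant hpm
    (fun β hβ => ae_eq_rescaledPressure hβ hdist hK hm hD hu)
  refine ⟨Q, hQm, hQ, ae_slab_of_ae_slices hpm ?_ hQ⟩
  exact (measurable_uncurry_selfSimilarCollapsePressure g hQm).aestronglyMeasurable

/-! ### The member form: the crux class with the slaved pressure -/

/-- **From the `D`-gauge to cylinder growth**: `a^{2ρ} D(a; p) ≤ c` for `a > 0` gives `∫∫_{Q_a(0)} |p|^{3/2} ≤ c · a^{2−2ρ}`. [folklore] -/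
theorem lintegral_cylinder_le_of_gaugeD {ρ : ℝ} {p : ℝ → EuclideanSpace ℝ (Fin 3) → ℝ} {c : ℝ≥0}
    (hc : ∀ a : ℝ, 0 < a →
      ENNReal.ofReal (a ^ (2 * ρ)) * cknD a (0 : ℝ × EuclideanSpace ℝ (Fin 3)) p ≤ (c : ℝ≥0∞))
    {a : ℝ} (ha : 0 < a) :
    ∫⁻ z in parabolicCylinder a (0 : ℝ × EuclideanSpace ℝ (Fin 3)), ‖p z.1 z.2‖ₑ ^ (3 / 2 : ℝ) ≤
      (c : ℝ≥0∞) * ENNReal.ofReal (a ^ (2 - 2 * ρ)) := by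
  set I := ∫⁻ z in parabolicCylinder a (0 : ℝ × EuclideanSpace ℝ (Fin 3)), ‖p z.1 z.2‖ₑ ^ (3 / 2 : ℝ) with hI
  have h := hc a ha
  unfold cknD at h
  rw [← hI] at h
  have h2 : ENNReal.ofReal a ^ 2 ≠ 0 := pow_ne_zero _ (by rwa [Ne, ENNReal.ofReal_eq_zero, not_le])
  have h2t : ENNReal.ofReal a ^ 2 ≠ ⊤ := ENNReal.pow_ne_top ENNReal.ofReal_ne_top
  have hρ0 : ENNReal.ofReal (a ^ (2 * ρ)) ≠ 0 := by
    rw [Ne, ENNReal.ofReal_eq_zero, not_le]; exact Real.rpow_pos_of_pos ha _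
  have hρt : ENNReal.ofReal (a ^ (2 * ρ)) ≠ ⊤ := ENNReal.ofReal_ne_top
  -- `I = a² · ((a²)⁻¹ I)` and `(a²)⁻¹ I ≤ c / a^{2ρ}`
  have hX : (ENNReal.ofReal a ^ 2)⁻¹ * I ≤ (c : ℝ≥0∞) / ENNReal.ofReal (a ^ (2 * ρ)) := by
    rw [ENNReal.le_div_iff_mul_le (Or.inl hρ0) (Or.inl hρt), mul_comm]
    exact h
  calc I = ENNReal.ofReal a ^ 2 * ((ENNReal.ofReal a ^ 2)⁻¹ * I) := by
        rw [← mul_assoc, ENNReal.mul_inv_cancel h2 h2t, one_mul]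
    _ ≤ ENNReal.ofReal a ^ 2 * ((c : ℝ≥0∞) / ENNReal.ofReal (a ^ (2 * ρ))) := by gcongr
    _ = (c : ℝ≥0∞) * (ENNReal.ofReal (a ^ 2) / ENNReal.ofReal (a ^ (2 * ρ))) := by
        rw [ENNReal.ofReal_pow ha.le]
        rw [ENNReal.div_eq_inv_mul, ENNReal.div_eq_inv_mul]
        ring
    _ = (c : ℝ≥0∞) * ENNReal.ofReal (a ^ (2 - 2 * ρ)) := by
        rw [← ENNReal.ofReal_div_of_pos (Real.rpow_pos_of_pos ha _),
          show (2 : ℝ) - 2 * ρ = ((2 : ℕ) : ℝ) - 2 * ρ by norm_num, Real.rpow_sub ha, Real.rpow_natCast]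

/-- **MEMBER FORM (C): THE CRUX CLASS WITH THE SLAVED PRESSURE.**  Crux binders verbatim (`InClass ρ u p H c` unfolded: suitable weak Euler
solution on the slab `(−∞,0) × ℝ³`, weak spatial gradient `H`, gauge bound `a^{2ρ} A(a; u) + a^{ρ} E(a; H) + a^{2ρ} D(a; p) ≤ c` for all
`a > 0`; any `ρ > −1/2`, so every `ρ` of the crux) + the velocity is exactly self-similar of ANY rate `g`, `u τ = selfSimilarCollapse g 0 V τ`
for `τ < 0` ⇒ there is a measurable profile `Q` such that, with the ansatz pressure `p_Q := selfSimilarCollapsePressure g 0 Q`: `p = p_Q` a.e. on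
the slab AND `(u, p_Q, H)` satisfies the three crux hypotheses with the SAME `c` (ns-ezl-w2 g2's swap `PressureSwap.inClass_congr_pressure_ae`).
Hence `InClass ρ u p H c → InClass ρ u p_Q H c`, and the pressure clause `∀ τ < 0, p_Q τ = selfSimilarCollapsePressure g 0 Q τ` of
`IsExactlySelfSimilar` / `IsOffRateSelfSimilar` holds by `rfl`: the LEAD may delete the pressure clauses of these strata.
[folklore; RusinSverak2011 §2 p. 4; CaffarelliKohnNirenberg1982 §2] -/
theorem inClass_selfSimilarPressure {ρ g : ℝ} (hρ : -1 / 2 < ρ)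
    {u : ℝ → EuclideanSpace ℝ (Fin 3) → EuclideanSpace ℝ (Fin 3)} {p : ℝ → EuclideanSpace ℝ (Fin 3) → ℝ}
    {H : ℝ → EuclideanSpace ℝ (Fin 3) → EuclideanSpace ℝ (Fin 3) →L[ℝ] EuclideanSpace ℝ (Fin 3)} {c : ℝ≥0}
    {V : EuclideanSpace ℝ (Fin 3) → EuclideanSpace ℝ (Fin 3)}
    (hcls : IsSuitableWeakSolutionOn (slab (EuclideanSpace ℝ (Fin 3)) (Iio 0) isOpen_Iio) 0 0 u p ∧
      HasWeakSpatialGradientOn (slab (EuclideanSpace ℝ (Fin 3)) (Iio 0) isOpen_Iio) u H ∧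
      (∀ a : ℝ, 0 < a →
        ENNReal.ofReal (a ^ (2 * ρ)) * cknA a (0 : ℝ × EuclideanSpace ℝ (Fin 3)) u +
              ENNReal.ofReal (a ^ ρ) * cknE a (0 : ℝ × EuclideanSpace ℝ (Fin 3)) H +
            ENNReal.ofReal (a ^ (2 * ρ)) * cknD a (0 : ℝ × EuclideanSpace ℝ (Fin 3)) p ≤ (c : ℝ≥0∞)))
    (hu : ∀ τ : ℝ, τ < 0 → u τ = selfSimilarCollapse g 0 V τ) :
    ∃ Q : EuclideanSpace ℝ (Fin 3) → ℝ, Measurable Q ∧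
      (∀ᵐ z ∂(volume.restrict (Iio (0 : ℝ) ×ˢ (univ : Set (EuclideanSpace ℝ (Fin 3))))),
        p z.1 z.2 = selfSimilarCollapsePressure g 0 Q z.1 z.2) ∧
      (IsSuitableWeakSolutionOn (slab (EuclideanSpace ℝ (Fin 3)) (Iio 0) isOpen_Iio) 0 0 u
          (selfSimilarCollapsePressure g 0 Q) ∧
        HasWeakSpatialGradientOn (slab (EuclideanSpace ℝ (Fin 3)) (Iio 0) isOpen_Iio) u H ∧
        (∀ a : ℝ, 0 < a →
          ENNReal.ofReal (a ^ (2 * ρ)) * cknA a (0 : ℝ × EuclideanSpace ℝ (Fin 3)) u +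
                ENNReal.ofReal (a ^ ρ) * cknE a (0 : ℝ × EuclideanSpace ℝ (Fin 3)) H +
              ENNReal.ofReal (a ^ (2 * ρ)) * cknD a (0 : ℝ × EuclideanSpace ℝ (Fin 3))
                (selfSimilarCollapsePressure g 0 Q) ≤ (c : ℝ≥0∞))) := by
  obtain ⟨hsw, hH, hc⟩ := hcls
  -- the `D`-gauge alone, as cylinder growth with exponent `m = 2 − 2ρ < 3`
  have hcD : ∀ a : ℝ, 0 < a →
      ENNReal.ofReal (a ^ (2 * ρ)) * cknD a (0 : ℝ × EuclideanSpace ℝ (Fin 3)) p ≤ (c : ℝ≥0∞) :=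
    fun a ha => le_trans le_add_self (hc a ha)
  have hD : ∀ a : ℝ, 1 ≤ a →
      ∫⁻ z in parabolicCylinder a (0 : ℝ × EuclideanSpace ℝ (Fin 3)), ‖p z.1 z.2‖ₑ ^ (3 / 2 : ℝ) ≤
        (c : ℝ≥0∞) * ENNReal.ofReal (a ^ (2 - 2 * ρ)) :=
    fun a ha => lintegral_cylinder_le_of_gaugeD hcD (one_pos.trans_le ha)
  obtain ⟨Q, hQm, -, hQ⟩ := exists_profilePressure hsw.distributional ENNReal.coe_ne_top (m := 2 - 2 * ρ)
    (by linarith) hD hu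
  refine ⟨Q, hQm, hQ, PressureSwap.inClass_congr_pressure_ae ⟨hsw, hH, hc⟩ ?_⟩
  filter_upwards [hQ] with z hz
  simpa only [uncurry] using hz.symm

end PressureSlaving

end Summit.NavierStokesRegularity.NavierStokesRegularity.Theorems.PowerGaugeEulerLiouville

end
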